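import Literature.MathematicalPhysics.QuantumFieldTheory.ConformalBootstrap3D.MixedOddRadial
import Literature.MathematicalPhysics.QuantumFieldTheory.ConformalBootstrap3D.MixedOddTail
import HarnessLib

/-!
# Closed-form rules for the radial odd term: (M^ρ) corner numbers, (T^ρ) apex numbers, (D5^ρ)

`MixedOddRadial` writes the odd sector `α⃗·V⃗_{-,Δ,ℓ}` of a mixed `σ–ε` point certificate, under the two
radial expansion hypotheses (`HasSignedRadialExpansion` for the `⟨σεσε⟩` block, `HasRadialExpansion` for
the prefactored `⟨εσσε⟩` block, common table `w_{m,j} ≥ 0` — Costa–Hansen–Penedones–Trevisani 2016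
§2.1–2.2 with Dolan–Osborn 2011 eq. (2.23)), as the series `Σ_{(m,j)} 𝔗_{m,j}` and gives the
parity-uniform termwise rule `|Φ³| ≤ Φ⁴⁵ ⇒ 𝔗_{m,j} ≥ 0`. This file makes that rule checkable by FINITELY
MANY NUMBERS, exactly parallel to the `z`-frame device of `MixedOddTail` ((M_odd), (T_odd), (D5)) and
reusing its objects (`twoWeightEval`, `cornerBound`-type sums, `oddDomEval`, `apexRest`):

* `oddTermRadial_eq_twoWeightEval`, `radialOdd45_eq`: with `s′ = (Δσ+Δε)/2` the `⟨εσσε⟩` prefactor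
  `v^{Δσ}·v^{-Δσε/2}` IS `v^{s′}`, so `𝔗_{m,j} = 4^Δ w_{m,j}·twoWeightEval(±w³+w⁴-w⁵, ±w³+w⁴+w⁵; s′;
  𝒫^ρ_{Δ+m,j})`, `± = (-1)^{ℓ+m}` — ONE function `𝒫^ρ_{E,j} = 𝒫_{E,j}∘(ρ,ρ)` (`radialMono`), one exponent;
* `mul_oddDomEval_le_oddTermRadial`: `𝔗_{m,j} ≥ 4^Δ w_{m,j}·𝔇_w[s′; 𝒫^ρ_{Δ+m,j}]` for BOTH parities, with
  the SAME dominating evaluation `𝔇_w[t;g] = φ_{w⁴}[F^t_-[g]] - φ_{w⁵}[F^t_+[g]] - φ_{|w³|}[F^t_+[g]]`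
  (`oddDomEval`) as in the `z`-frame — there applied to `g^{-Δσε,Δσε}` at exponent `Δσ` after a
  Cauchy–Schwarz budget of the `⟨σεσε⟩` row, here applied to the radial monomial at exponent `s′` with
  NO budget (the two rows share the table `w`);
* (M^ρ) `cornerBoundρ`, `cornerBoundρ_le`, `oddDomEval_radialMono_nonneg_of_cornerBoundρ`: one number per
  box `E ∈ [E₁,E₂]`, `s′ ∈ [s_lo,s_hi]` (`𝒫^ρ_{E,j}` is non-increasing in `E` on the open square, as `𝒫_{E,j}`);
* (T^ρ) `abs_pointFunctional_crossF_radialMono_sub_apex_le`, `oddDomEval_radialMono_nonneg_of_apex`: the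
  apex estimate of `MixedEvenTail` with the domination ratios measured between the RADIAL IMAGES of the
  nodes (`ρ(z_k)ρ(z̄_k) ≤ q_k² ρ(z_a)ρ(z̄_a)`, `ρ(z_k) ≤ q_k ρ(z_a)`, and the reflected ones), the remainder
  `apexRest` (prefactors at the nodes themselves) unchanged;
* (D5^ρ) `tail_oddPositive_of_radial_rules`: at any `(Δ, ℓ)`, `Δ ≥ E₀`, where every typed pair of
  odd-sector blocks carries the two expansions with a common non-negative table supported on `j ≤ ℓ+m`
  (`RadialPairClause` — the content of a radial block clause "A2ρ" at that point; a HYPOTHESIS), (M^ρ) on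
  `E ∈ [E₀,E_T)`, `j+τ ≤ E` and (T^ρ) on `E ≥ E_T`, `j ≤ E` give `OddPositive` — every spin, either parity;
  `tail_oddPositive_of_radial_boxes_and_apex` is the box version with the apex numbers spelled out.

Nothing here asserts that typed blocks have radial expansions; no named fact is introduced.
-/

namespace Literature.MathematicalPhysics.QuantumFieldTheory.ConformalBootstrap3D

open Finset Set Filter Topology

/-! ### Auxiliary: monotonicity of `ρ` and of the radial monomial -/

/-- `ρ` is non-decreasing on `(-∞, 1]`. [folklore] -/
theorem rhoOf_le_rhoOf {x y : ℝ} (hxy : x ≤ y) (hy : y ≤ 1) : rhoOf x ≤ rhoOf y := by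
  rcases eq_or_lt_of_le hxy with h | h
  · rw [h]
  · exact (rhoOf_lt_rhoOf h hy).le

/-- `𝒫^ρ_{E,j}(x,y)` is non-increasing in `E` at a point of the open square (`0 < ρ(x), ρ(y) < 1`).
[folklore] -/
theorem radialMono_le_radialMono_of_le {x y : ℝ} (hx : 0 < x) (hx1 : x < 1) (hy : 0 < y)
    (hy1 : y < 1) (j : ℕ) {E₁ E₂ : ℝ} (h : E₁ ≤ E₂) :
    radialMono E₂ j x y ≤ radialMono E₁ j x y :=
  zMono_le_zMono_of_le (rhoOf_pos hx) (rhoOf_lt_one hx1) (rhoOf_pos hy) (rhoOf_lt_one hy1) j h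

/-! ### The radial odd term as a two-weight evaluation of ONE radial monomial -/

/-- **`𝔗_{m,j} = 4^Δ w_{m,j} · twoWeightEval(±w³ + w⁴ - w⁵, ±w³ + w⁴ + w⁵; s′; 𝒫^ρ_{Δ+m,j})`** with
`± = (-1)^{ℓ+m}` and `s′ = (Δσ+Δε)/2`: since `Δσ - Δσε/2 = s′`, the `⟨εσσε⟩` rows see the SAME prefactor
exponent as the `⟨σεσε⟩` row, so the whole radial odd term is a two-weight point evaluation
(`twoWeightEval`) of the single function `𝒫^ρ_{E,j}` — direct weights `±w³_k + w⁴_k - w⁵_k` on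
`v_k^{s′}𝒫^ρ_{E,j}(z_k,z̄_k)`, reflected weights `±w³_k + w⁴_k + w⁵_k` on `u_k^{s′}𝒫^ρ_{E,j}(1-z_k,1-z̄_k)`.
[folklore] -/
theorem oddTermRadial_eq_twoWeightEval {N : ℕ} (z zb : Fin N → ℝ) (w : Fin 5 → Fin N → ℝ)
    (hz : ∀ k, z k ∈ Ioo (0 : ℝ) 1) (hzb : ∀ k, zb k ∈ Ioo (0 : ℝ) 1) (Δσ Δε Δ : ℝ)
    (wr : ℕ × ℕ → ℝ) (ℓ : ℕ) (q : ℕ × ℕ) :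
    oddTermRadial z zb w Δσ Δε Δ wr ℓ q =
      (4 : ℝ) ^ Δ * wr q *
        twoWeightEval (fun k => (-1 : ℝ) ^ (ℓ + q.1) * w 2 k + w 3 k - w 4 k)
          (fun k => (-1 : ℝ) ^ (ℓ + q.1) * w 2 k + w 3 k + w 4 k) z zb ((Δσ + Δε) / 2)
          (radialMono (Δ + (q.1 : ℝ)) q.2) := by
  unfold oddTermRadial radialOdd3 radialOdd45 twoWeightEval
  congr 1
  simp only [pointFunctional_apply, crossF, radialMonoV, sub_sub_cancel, Finset.mul_sum,
    ← Finset.sum_sub_distrib, ← Finset.sum_add_distrib]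
  refine Finset.sum_congr rfl fun k _ => ?_
  have hv : 0 < (1 - z k) * (1 - zb k) := mul_pos (by linarith [(hz k).2]) (by linarith [(hzb k).2])
  have hu : 0 < z k * zb k := mul_pos (hz k).1 (hzb k).1
  have e1 : ((1 - z k) * (1 - zb k)) ^ ((Δσ + Δε) / 2) =
      ((1 - z k) * (1 - zb k)) ^ Δσ * ((1 - z k) * (1 - zb k)) ^ (-((Δσ - Δε) / 2)) := by
    rw [← Real.rpow_add hv]; congr 1; ring
  have e2 : (z k * zb k) ^ ((Δσ + Δε) / 2) =
      (z k * zb k) ^ Δσ * (z k * zb k) ^ (-((Δσ - Δε) / 2)) := by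
    rw [← Real.rpow_add hu]; congr 1; ring
  rw [e1, e2]
  ring

/-- `Φ⁴⁵(E,j) = φ_{w⁴}[F^{s′}_-[𝒫^ρ_{E,j}]] - φ_{w⁵}[F^{s′}_+[𝒫^ρ_{E,j}]]`, `s′ = (Δσ+Δε)/2` (nodes in the
open square): the `⟨εσσε⟩` prefactor merges, `v^{Δσ}·v^{-Δσε/2} = v^{s′}`. [folklore] -/
theorem radialOdd45_eq {N : ℕ} (z zb : Fin N → ℝ) (w : Fin 5 → Fin N → ℝ)
    (hz : ∀ k, z k ∈ Ioo (0 : ℝ) 1) (hzb : ∀ k, zb k ∈ Ioo (0 : ℝ) 1) (Δσ Δε E : ℝ) (j : ℕ) :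
    radialOdd45 z zb w Δσ Δε E j =
      pointFunctional (w 3) z zb (crossF ((Δσ + Δε) / 2) (-1) (radialMono E j)) -
        pointFunctional (w 4) z zb (crossF ((Δσ + Δε) / 2) 1 (radialMono E j)) := by
  unfold radialOdd45
  simp only [pointFunctional_apply, crossF, radialMonoV, sub_sub_cancel, ← Finset.sum_sub_distrib]
  refine Finset.sum_congr rfl fun k _ => ?_
  have hv : 0 < (1 - z k) * (1 - zb k) := mul_pos (by linarith [(hz k).2]) (by linarith [(hzb k).2])
  have hu : 0 < z k * zb k := mul_pos (hz k).1 (hzb k).1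
  have e1 : ((1 - z k) * (1 - zb k)) ^ ((Δσ + Δε) / 2) =
      ((1 - z k) * (1 - zb k)) ^ Δσ * ((1 - z k) * (1 - zb k)) ^ (-((Δσ - Δε) / 2)) := by
    rw [← Real.rpow_add hv]; congr 1; ring
  have e2 : (z k * zb k) ^ ((Δσ + Δε) / 2) =
      (z k * zb k) ^ Δσ * (z k * zb k) ^ (-((Δσ - Δε) / 2)) := by
    rw [← Real.rpow_add hu]; congr 1; ring
  rw [e1, e2]
  ring

/-- `|φ_w[F^{s}_{sign}[g]]| ≤ φ_{|w|}[F^{s}_{+}[g]]` for `|sign| ≤ 1` and `g ≥ 0` at the nodes and at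
their reflections. [folklore] -/
theorem abs_pointFunctional_crossF_le_abs_weights {N : ℕ} (w z zb : Fin N → ℝ)
    (hz : ∀ k, z k ∈ Ioo (0 : ℝ) 1) (hzb : ∀ k, zb k ∈ Ioo (0 : ℝ) 1) (s sign : ℝ)
    (hsign : |sign| ≤ 1) {g : ℝ → ℝ → ℝ} (hg : ∀ k, 0 ≤ g (z k) (zb k))
    (hg' : ∀ k, 0 ≤ g (1 - z k) (1 - zb k)) :
    |pointFunctional w z zb (crossF s sign g)| ≤
      pointFunctional (fun k => |w k|) z zb (crossF s 1 g) := by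
  rw [pointFunctional_apply, pointFunctional_apply]
  refine (abs_sum_le_sum_abs _ _).trans (sum_le_sum fun k _ => ?_)
  rw [abs_mul]
  refine mul_le_mul_of_nonneg_left ?_ (abs_nonneg _)
  have hv : 0 ≤ ((1 - z k) * (1 - zb k)) ^ s :=
    Real.rpow_nonneg (mul_nonneg (by linarith [(hz k).2]) (by linarith [(hzb k).2])) s
  have hu : 0 ≤ (z k * zb k) ^ s := Real.rpow_nonneg (mul_nonneg (hz k).1.le (hzb k).1.le) s
  unfold crossF
  refine (abs_add_le _ _).trans ?_
  rw [abs_of_nonneg (mul_nonneg hv (hg k)), abs_mul, abs_mul, abs_of_nonneg hu,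
    abs_of_nonneg (hg' k), one_mul]
  have : |sign| * (z k * zb k) ^ s * g (1 - z k) (1 - zb k) ≤
      1 * (z k * zb k) ^ s * g (1 - z k) (1 - zb k) :=
    mul_le_mul_of_nonneg_right (mul_le_mul_of_nonneg_right hsign hu) (hg' k)
  linarith

/-- **`𝔗_{m,j} ≥ 4^Δ w_{m,j} · 𝔇_w[s′; 𝒫^ρ_{Δ+m,j}]`** for `w_{m,j} ≥ 0` and BOTH parities of `ℓ + m`
(`(-1)^{ℓ+m}Φ³ ≥ -|Φ³| ≥ -φ_{|w³|}[F^{s′}_+[𝒫^ρ]]`): the dominating evaluation `𝔇` of the `z`-frame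
device (`oddDomEval`), applied to the radial monomial at exponent `s′ = (Δσ+Δε)/2`. [folklore] -/
theorem mul_oddDomEval_le_oddTermRadial {N : ℕ} (z zb : Fin N → ℝ) (w : Fin 5 → Fin N → ℝ)
    (hz : ∀ k, z k ∈ Ioo (0 : ℝ) 1) (hzb : ∀ k, zb k ∈ Ioo (0 : ℝ) 1) (Δσ Δε Δ : ℝ)
    {wr : ℕ × ℕ → ℝ} (ℓ : ℕ) (q : ℕ × ℕ) (hw : 0 ≤ wr q) :
    (4 : ℝ) ^ Δ * wr q * oddDomEval z zb w ((Δσ + Δε) / 2) (radialMono (Δ + (q.1 : ℝ)) q.2) ≤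
      oddTermRadial z zb w Δσ Δε Δ wr ℓ q := by
  unfold oddTermRadial
  refine mul_le_mul_of_nonneg_left ?_ (mul_nonneg (Real.rpow_nonneg (by norm_num) Δ) hw)
  rw [radialOdd45_eq z zb w hz hzb]
  unfold oddDomEval radialOdd3
  have hb := abs_pointFunctional_crossF_le_abs_weights (w 2) z zb hz hzb ((Δσ + Δε) / 2) (-1)
    (by simp) (g := radialMono (Δ + (q.1 : ℝ)) q.2)
    (fun k => radialMono_nonneg _ _ (hz k).1.le (hzb k).1.le)
    (fun k => radialMono_nonneg _ _ (by linarith [(hz k).2]) (by linarith [(hzb k).2]))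
  have hsgn : -|pointFunctional (w 2) z zb (crossF ((Δσ + Δε) / 2) (-1)
      (radialMono (Δ + (q.1 : ℝ)) q.2))| ≤
      (-1 : ℝ) ^ (ℓ + q.1) * pointFunctional (w 2) z zb (crossF ((Δσ + Δε) / 2) (-1)
        (radialMono (Δ + (q.1 : ℝ)) q.2)) := by
    rcases neg_one_pow_eq_or ℝ (ℓ + q.1) with h | h
    · rw [h, one_mul]; exact neg_abs_le _
    · rw [h, neg_one_mul]; exact neg_le_neg (le_abs_self _)
  linarith

/-- **Termwise, parity-uniform**: `w_{m,j} ≥ 0` and `𝔇_w[s′; 𝒫^ρ_{Δ+m,j}] ≥ 0` ⇒ `𝔗_{m,j} ≥ 0`. [folklore] -/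
theorem oddTermRadial_nonneg_of_oddDomEval_nonneg {N : ℕ} (z zb : Fin N → ℝ)
    (w : Fin 5 → Fin N → ℝ) (hz : ∀ k, z k ∈ Ioo (0 : ℝ) 1) (hzb : ∀ k, zb k ∈ Ioo (0 : ℝ) 1)
    (Δσ Δε Δ : ℝ) {wr : ℕ × ℕ → ℝ} (ℓ : ℕ) (q : ℕ × ℕ) (hw : 0 ≤ wr q)
    (hD : 0 ≤ oddDomEval z zb w ((Δσ + Δε) / 2) (radialMono (Δ + (q.1 : ℝ)) q.2)) :
    0 ≤ oddTermRadial z zb w Δσ Δε Δ wr ℓ q :=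
  (mul_nonneg (mul_nonneg (Real.rpow_nonneg (by norm_num) Δ) hw) hD).trans
    (mul_oddDomEval_le_oddTermRadial z zb w hz hzb Δσ Δε Δ ℓ q hw)

/-! ### Rule (M^ρ): one box, one number -/

/-- **Radial corner bound** for a two-weight evaluation of `𝒫^ρ_{E,j}` on the box `E ∈ [E₁, E₂]`,
`s ∈ [s_lo, s_hi]`: positive parts of the weights at the far corner `(E₂, s_hi)`, negative parts at the
near corner `(E₁, s_lo)`; prefactors at the nodes, monomials at their radial images (`cornerBound₂` with
`𝒫 ↦ 𝒫^ρ`). [folklore] -/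
noncomputable def cornerBoundρ {N : ℕ} (c d z zb : Fin N → ℝ) (j : ℕ) (E₁ E₂ slo shi : ℝ) : ℝ :=
  ∑ k, ((max (c k) 0 * (((1 - z k) * (1 - zb k)) ^ shi * radialMono E₂ j (z k) (zb k))
        - max (-(c k)) 0 * (((1 - z k) * (1 - zb k)) ^ slo * radialMono E₁ j (z k) (zb k)))
      + (max (-(d k)) 0 * ((z k * zb k) ^ shi * radialMono E₂ j (1 - z k) (1 - zb k))
        - max (d k) 0 * ((z k * zb k) ^ slo * radialMono E₁ j (1 - z k) (1 - zb k))))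

/-- **The radial corner bound is a lower bound on the whole box.** [folklore] -/
theorem cornerBoundρ_le {N : ℕ} (c d z zb : Fin N → ℝ)
    (hz : ∀ k, z k ∈ Ioo (0 : ℝ) 1) (hzb : ∀ k, zb k ∈ Ioo (0 : ℝ) 1) (j : ℕ)
    {E₁ E₂ slo shi E s : ℝ} (hE : E ∈ Icc E₁ E₂) (hs : s ∈ Icc slo shi) :
    cornerBoundρ c d z zb j E₁ E₂ slo shi ≤ twoWeightEval c d z zb s (radialMono E j) := by
  unfold cornerBoundρ twoWeightEval
  refine sum_le_sum fun k _ => ?_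
  have hz0 := (hz k).1; have hz1 := (hz k).2; have hzb0 := (hzb k).1; have hzb1 := (hzb k).2
  have hv : 0 < (1 - z k) * (1 - zb k) ∧ (1 - z k) * (1 - zb k) ≤ 1 :=
    ⟨mul_pos (by linarith) (by linarith), mul_le_one₀ (by linarith) (by linarith) (by linarith)⟩
  have hu : 0 < z k * zb k ∧ z k * zb k ≤ 1 := ⟨mul_pos hz0 hzb0, mul_le_one₀ hz1.le hzb0.le hzb1.le⟩
  have hM1 : radialMono E j (z k) (zb k) ≤ radialMono E₁ j (z k) (zb k) :=
    radialMono_le_radialMono_of_le hz0 hz1 hzb0 hzb1 j hE.1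
  have hM2 : radialMono E₂ j (z k) (zb k) ≤ radialMono E j (z k) (zb k) :=
    radialMono_le_radialMono_of_le hz0 hz1 hzb0 hzb1 j hE.2
  have hR1 : radialMono E j (1 - z k) (1 - zb k) ≤ radialMono E₁ j (1 - z k) (1 - zb k) :=
    radialMono_le_radialMono_of_le (by linarith) (by linarith) (by linarith) (by linarith) j hE.1
  have hR2 : radialMono E₂ j (1 - z k) (1 - zb k) ≤ radialMono E j (1 - z k) (1 - zb k) :=
    radialMono_le_radialMono_of_le (by linarith) (by linarith) (by linarith) (by linarith) j hE.2
  have hv1 : ((1 - z k) * (1 - zb k)) ^ s ≤ ((1 - z k) * (1 - zb k)) ^ slo :=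
    Real.rpow_le_rpow_of_exponent_ge hv.1 hv.2 hs.1
  have hv2 : ((1 - z k) * (1 - zb k)) ^ shi ≤ ((1 - z k) * (1 - zb k)) ^ s :=
    Real.rpow_le_rpow_of_exponent_ge hv.1 hv.2 hs.2
  have hu1 : (z k * zb k) ^ s ≤ (z k * zb k) ^ slo := Real.rpow_le_rpow_of_exponent_ge hu.1 hu.2 hs.1
  have hu2 : (z k * zb k) ^ shi ≤ (z k * zb k) ^ s := Real.rpow_le_rpow_of_exponent_ge hu.1 hu.2 hs.2
  have hMn : ∀ E', 0 ≤ radialMono E' j (z k) (zb k) := fun E' =>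
    radialMono_nonneg E' j hz0.le hzb0.le
  have hRn : ∀ E', 0 ≤ radialMono E' j (1 - z k) (1 - zb k) := fun E' =>
    radialMono_nonneg E' j (by linarith) (by linarith)
  have h1 : ((1 - z k) * (1 - zb k)) ^ shi * radialMono E₂ j (z k) (zb k) ≤
      ((1 - z k) * (1 - zb k)) ^ s * radialMono E j (z k) (zb k) :=
    mul_le_mul hv2 hM2 (hMn _) (Real.rpow_nonneg hv.1.le _)
  have h2 : ((1 - z k) * (1 - zb k)) ^ s * radialMono E j (z k) (zb k) ≤
      ((1 - z k) * (1 - zb k)) ^ slo * radialMono E₁ j (z k) (zb k) :=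
    mul_le_mul hv1 hM1 (hMn _) (Real.rpow_nonneg hv.1.le _)
  have h3 : (z k * zb k) ^ shi * radialMono E₂ j (1 - z k) (1 - zb k) ≤
      (z k * zb k) ^ s * radialMono E j (1 - z k) (1 - zb k) :=
    mul_le_mul hu2 hR2 (hRn _) (Real.rpow_nonneg hu.1.le _)
  have h4 : (z k * zb k) ^ s * radialMono E j (1 - z k) (1 - zb k) ≤
      (z k * zb k) ^ slo * radialMono E₁ j (1 - z k) (1 - zb k) :=
    mul_le_mul hu1 hR1 (hRn _) (Real.rpow_nonneg hu.1.le _)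
  have i1 := max_mul_sub_max_mul_le (w := c k) h1 h2
  have i2 := max_neg_mul_sub_max_mul_le (w := d k) h3 h4
  calc (max (c k) 0 * (((1 - z k) * (1 - zb k)) ^ shi * radialMono E₂ j (z k) (zb k))
        - max (-(c k)) 0 * (((1 - z k) * (1 - zb k)) ^ slo * radialMono E₁ j (z k) (zb k)))
      + (max (-(d k)) 0 * ((z k * zb k) ^ shi * radialMono E₂ j (1 - z k) (1 - zb k))
        - max (d k) 0 * ((z k * zb k) ^ slo * radialMono E₁ j (1 - z k) (1 - zb k)))
      ≤ c k * (((1 - z k) * (1 - zb k)) ^ s * radialMono E j (z k) (zb k))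
        + -(d k * ((z k * zb k) ^ s * radialMono E j (1 - z k) (1 - zb k))) := add_le_add i1 i2
    _ = c k * ((1 - z k) * (1 - zb k)) ^ s * radialMono E j (z k) (zb k)
        - d k * (z k * zb k) ^ s * radialMono E j (1 - z k) (1 - zb k) := by ring

/-- **(M^ρ_odd) on a box from one number.** `cornerBoundρ (w⁴-w⁵-|w³|) (w⁴+w⁵+|w³|) j E₁ E₂ s_lo s_hi ≥ 0`
gives `𝔇_w[t; 𝒫^ρ_{E,j}] ≥ 0` for every `E ∈ [E₁,E₂]`, `t ∈ [s_lo,s_hi]`. [folklore] -/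
theorem oddDomEval_radialMono_nonneg_of_cornerBoundρ {N : ℕ} (z zb : Fin N → ℝ)
    (w : Fin 5 → Fin N → ℝ) (hz : ∀ k, z k ∈ Ioo (0 : ℝ) 1) (hzb : ∀ k, zb k ∈ Ioo (0 : ℝ) 1)
    (j : ℕ) {E₁ E₂ slo shi : ℝ}
    (h : 0 ≤ cornerBoundρ (fun k => w 3 k - w 4 k - |w 2 k|) (fun k => w 3 k + w 4 k + |w 2 k|)
      z zb j E₁ E₂ slo shi)
    {E t : ℝ} (hE : E ∈ Icc E₁ E₂) (ht : t ∈ Icc slo shi) :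
    0 ≤ oddDomEval z zb w t (radialMono E j) := by
  rw [oddDomEval_eq_twoWeightEval]
  exact h.trans (cornerBoundρ_le _ _ z zb hz hzb j hE ht)

/-! ### Rule (T^ρ): the apex estimate with radial domination ratios -/

/-- **Two-sided radial apex estimate.** In the RADIALLY dominated configuration (apex `a`;
`ρ(z_k)ρ(z̄_k) ≤ qd_k² ρ(z_a)ρ(z̄_a)`, `ρ(z_k) ≤ qd_k ρ(z_a)`; `ρ(1-z_k)ρ(1-z̄_k) ≤ qr_k² ρ(z_a)ρ(z̄_a)`,
`ρ(1-z̄_k) ≤ qr_k ρ(z_a)`), for `j ≤ E` and any `|sign| ≤ 1`: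
`|φ_w[F^{t}_{sign}[𝒫^ρ_{E,j}]] - w_a v_a^t 𝒫^ρ_{E,j}(z_a,z̄_a)| ≤ 𝒫^ρ_{E,j}(z_a,z̄_a) · R(w; t, E)` with the
remainder `R = apexRest` of `MixedEvenTail` (prefactors `v_k^t`, `u_k^t` at the nodes, ratios `qd_k^E`,
`qr_k^E`). [folklore] -/
theorem abs_pointFunctional_crossF_radialMono_sub_apex_le {N : ℕ} (w z zb : Fin N → ℝ)
    (hz : ∀ k, z k ∈ Ioo (0 : ℝ) 1) (hzb : ∀ k, zb k ∈ Ioo (0 : ℝ) 1) (hord : ∀ k, zb k ≤ z k)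
    (a : Fin N) (qd qr : Fin N → ℝ) (hqd : ∀ k, 0 < qd k) (hqr : ∀ k, 0 < qr k)
    (hdomd : ∀ k, rhoOf (z k) * rhoOf (zb k) ≤ qd k ^ 2 * (rhoOf (z a) * rhoOf (zb a)) ∧
      rhoOf (z k) ≤ qd k * rhoOf (z a))
    (hdomr : ∀ k, rhoOf (1 - z k) * rhoOf (1 - zb k) ≤ qr k ^ 2 * (rhoOf (z a) * rhoOf (zb a)) ∧
      rhoOf (1 - zb k) ≤ qr k * rhoOf (z a))
    {E : ℝ} {j : ℕ} (hjE : (j : ℝ) ≤ E) (t sign : ℝ) (hsign : |sign| ≤ 1) :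
    |pointFunctional w z zb (crossF t sign (radialMono E j)) -
        w a * ((1 - z a) * (1 - zb a)) ^ t * radialMono E j (z a) (zb a)| ≤
      radialMono E j (z a) (zb a) * apexRest w z zb a qd qr t E := by
  have hv0 : ∀ k, 0 ≤ (1 - z k) * (1 - zb k) := fun k =>
    mul_nonneg (by linarith [(hz k).2]) (by linarith [(hzb k).2])
  have hu0 : ∀ k, 0 ≤ z k * zb k := fun k => mul_nonneg (hz k).1.le (hzb k).1.le
  have hM0 : ∀ k, 0 ≤ radialMono E j (z k) (zb k) := fun k =>
    radialMono_nonneg E j (hz k).1.le (hzb k).1.le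
  have hR0 : ∀ k, 0 ≤ radialMono E j (1 - z k) (1 - zb k) := fun k =>
    radialMono_nonneg E j (by linarith [(hz k).2]) (by linarith [(hzb k).2])
  have hya : 0 < rhoOf (zb a) := rhoOf_pos (hzb a).1
  have hyxa : rhoOf (zb a) ≤ rhoOf (z a) := rhoOf_le_rhoOf (hord a) (hz a).2.le
  have hMk : ∀ k, radialMono E j (z k) (zb k) ≤ qd k ^ E * radialMono E j (z a) (zb a) := fun k =>
    zMono_le_of_dominated (rhoOf_pos (hzb k).1) (rhoOf_le_rhoOf (hord k) (hz k).2.le) hya hyxa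
      (hqd k) (hdomd k).1 (hdomd k).2 hjE
  have hRk : ∀ k, radialMono E j (1 - z k) (1 - zb k) ≤ qr k ^ E * radialMono E j (z a) (zb a) := by
    intro k
    unfold radialMono
    rw [← zMono_symm E j (rhoOf (1 - z k)) (rhoOf (1 - zb k))]
    have h1 : rhoOf (1 - zb k) * rhoOf (1 - z k) ≤ qr k ^ 2 * (rhoOf (z a) * rhoOf (zb a)) := by
      rw [mul_comm]; exact (hdomr k).1
    exact zMono_le_of_dominated (rhoOf_pos (by linarith [(hz k).2]))
      (rhoOf_le_rhoOf (by linarith [hord k]) (by linarith [(hzb k).1])) hya hyxa (hqr k) h1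
      (hdomr k).2 hjE
  set P := radialMono E j (z a) (zb a) with hP
  -- the decomposition Φ - (apex direct term) = Σ_{k≠a} direct + Σ_k reflected
  have hdec : pointFunctional w z zb (crossF t sign (radialMono E j)) -
      w a * ((1 - z a) * (1 - zb a)) ^ t * radialMono E j (z a) (zb a) =
      ∑ k ∈ univ.erase a, w k * ((1 - z k) * (1 - zb k)) ^ t * radialMono E j (z k) (zb k) +
        ∑ k, sign * w k * (z k * zb k) ^ t * radialMono E j (1 - z k) (1 - zb k) := by
    rw [pointFunctional_apply]
    have hsplit : ∑ k, w k * crossF t sign (radialMono E j) (z k) (zb k) =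
        ∑ k, w k * ((1 - z k) * (1 - zb k)) ^ t * radialMono E j (z k) (zb k) +
          ∑ k, sign * w k * (z k * zb k) ^ t * radialMono E j (1 - z k) (1 - zb k) := by
      rw [← sum_add_distrib]
      refine sum_congr rfl fun k _ => ?_
      simp only [crossF]
      ring
    rw [hsplit, ← add_sum_erase univ (fun k => w k * ((1 - z k) * (1 - zb k)) ^ t *
      radialMono E j (z k) (zb k)) (mem_univ a)]
    ring
  rw [hdec]
  have hb1 : ∀ k, |w k * ((1 - z k) * (1 - zb k)) ^ t * radialMono E j (z k) (zb k)| ≤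
      |w k| * ((1 - z k) * (1 - zb k)) ^ t * qd k ^ E * P := by
    intro k
    rw [abs_mul, abs_mul, abs_of_nonneg (Real.rpow_nonneg (hv0 k) t), abs_of_nonneg (hM0 k)]
    have := mul_le_mul_of_nonneg_left (hMk k)
      (mul_nonneg (abs_nonneg (w k)) (Real.rpow_nonneg (hv0 k) t))
    calc |w k| * ((1 - z k) * (1 - zb k)) ^ t * radialMono E j (z k) (zb k)
        ≤ |w k| * ((1 - z k) * (1 - zb k)) ^ t * (qd k ^ E * radialMono E j (z a) (zb a)) := this
      _ = |w k| * ((1 - z k) * (1 - zb k)) ^ t * qd k ^ E * P := by rw [hP]; ring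
  have hb2 : ∀ k, |sign * w k * (z k * zb k) ^ t * radialMono E j (1 - z k) (1 - zb k)| ≤
      |w k| * (z k * zb k) ^ t * qr k ^ E * P := by
    intro k
    rw [abs_mul, abs_mul, abs_mul, abs_of_nonneg (Real.rpow_nonneg (hu0 k) t),
      abs_of_nonneg (hR0 k)]
    have h1 : |sign| * |w k| * (z k * zb k) ^ t * radialMono E j (1 - z k) (1 - zb k) ≤
        1 * |w k| * (z k * zb k) ^ t * radialMono E j (1 - z k) (1 - zb k) :=
      mul_le_mul_of_nonneg_right (mul_le_mul_of_nonneg_right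
        (mul_le_mul_of_nonneg_right hsign (abs_nonneg _)) (Real.rpow_nonneg (hu0 k) t)) (hR0 k)
    have h2 := mul_le_mul_of_nonneg_left (hRk k)
      (mul_nonneg (abs_nonneg (w k)) (Real.rpow_nonneg (hu0 k) t))
    calc |sign| * |w k| * (z k * zb k) ^ t * radialMono E j (1 - z k) (1 - zb k)
        ≤ 1 * |w k| * (z k * zb k) ^ t * radialMono E j (1 - z k) (1 - zb k) := h1
      _ = |w k| * (z k * zb k) ^ t * radialMono E j (1 - z k) (1 - zb k) := by ring
      _ ≤ |w k| * (z k * zb k) ^ t * (qr k ^ E * radialMono E j (z a) (zb a)) := h2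
      _ = |w k| * (z k * zb k) ^ t * qr k ^ E * P := by rw [hP]; ring
  calc |∑ k ∈ univ.erase a, w k * ((1 - z k) * (1 - zb k)) ^ t * radialMono E j (z k) (zb k) +
          ∑ k, sign * w k * (z k * zb k) ^ t * radialMono E j (1 - z k) (1 - zb k)|
      ≤ |∑ k ∈ univ.erase a, w k * ((1 - z k) * (1 - zb k)) ^ t * radialMono E j (z k) (zb k)| +
          |∑ k, sign * w k * (z k * zb k) ^ t * radialMono E j (1 - z k) (1 - zb k)| := abs_add_le _ _
    _ ≤ ∑ k ∈ univ.erase a, |w k * ((1 - z k) * (1 - zb k)) ^ t * radialMono E j (z k) (zb k)| +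
          ∑ k, |sign * w k * (z k * zb k) ^ t * radialMono E j (1 - z k) (1 - zb k)| :=
        add_le_add (abs_sum_le_sum_abs _ _) (abs_sum_le_sum_abs _ _)
    _ ≤ ∑ k ∈ univ.erase a, |w k| * ((1 - z k) * (1 - zb k)) ^ t * qd k ^ E * P +
          ∑ k, |w k| * (z k * zb k) ^ t * qr k ^ E * P :=
        add_le_add (sum_le_sum fun k _ => hb1 k) (sum_le_sum fun k _ => hb2 k)
    _ = P * apexRest w z zb a qd qr t E := by
        rw [apexRest, mul_add, mul_sum, mul_sum]
        congr 1 <;> exact sum_congr rfl fun k _ => by ring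

/-- One-sided forms of the radial apex estimate. [folklore] -/
theorem apex_bounds_pointFunctional_crossF_radialMono {N : ℕ} (w z zb : Fin N → ℝ)
    (hz : ∀ k, z k ∈ Ioo (0 : ℝ) 1) (hzb : ∀ k, zb k ∈ Ioo (0 : ℝ) 1) (hord : ∀ k, zb k ≤ z k)
    (a : Fin N) (qd qr : Fin N → ℝ) (hqd : ∀ k, 0 < qd k) (hqr : ∀ k, 0 < qr k)
    (hdomd : ∀ k, rhoOf (z k) * rhoOf (zb k) ≤ qd k ^ 2 * (rhoOf (z a) * rhoOf (zb a)) ∧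
      rhoOf (z k) ≤ qd k * rhoOf (z a))
    (hdomr : ∀ k, rhoOf (1 - z k) * rhoOf (1 - zb k) ≤ qr k ^ 2 * (rhoOf (z a) * rhoOf (zb a)) ∧
      rhoOf (1 - zb k) ≤ qr k * rhoOf (z a))
    {E : ℝ} {j : ℕ} (hjE : (j : ℝ) ≤ E) (t sign : ℝ) (hsign : |sign| ≤ 1) :
    radialMono E j (z a) (zb a) * (w a * ((1 - z a) * (1 - zb a)) ^ t - apexRest w z zb a qd qr t E) ≤
        pointFunctional w z zb (crossF t sign (radialMono E j)) ∧
      pointFunctional w z zb (crossF t sign (radialMono E j)) ≤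
        radialMono E j (z a) (zb a) * (w a * ((1 - z a) * (1 - zb a)) ^ t + apexRest w z zb a qd qr t E) := by
  have h := abs_pointFunctional_crossF_radialMono_sub_apex_le w z zb hz hzb hord a qd qr hqd hqr hdomd hdomr
    hjE t sign hsign
  rw [abs_le] at h
  constructor
  · nlinarith [h.1]
  · nlinarith [h.2]


/-- **(T^ρ_odd).** In the radially dominated configuration (apex `a`), with `v_a = (1-z_a)(1-z̄_a)`: the
checks `w⁴_a - w⁵_a - |w³_a| ≥ 0` and
`R(w⁴; s_lo, E_T) + R(w⁵; s_lo, E_T) + R(|w³|; s_lo, E_T) ≤ (w⁴_a - w⁵_a - |w³_a|) v_a^{s_hi}` give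
`𝔇_w[t; 𝒫^ρ_{E,j}] ≥ 0` for every `E ≥ E_T`, `j ≤ E`, `t ∈ [s_lo, s_hi]` (as `oddDomEval_nonneg_of_apex`,
monomial at the radial images). [folklore] -/
theorem oddDomEval_radialMono_nonneg_of_apex {N : ℕ} (z zb : Fin N → ℝ) (w : Fin 5 → Fin N → ℝ)
    (hz : ∀ k, z k ∈ Ioo (0 : ℝ) 1) (hzb : ∀ k, zb k ∈ Ioo (0 : ℝ) 1) (hord : ∀ k, zb k ≤ z k)
    (a : Fin N) (qd qr : Fin N → ℝ) (hqd : ∀ k, 0 < qd k ∧ qd k ≤ 1)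
    (hqr : ∀ k, 0 < qr k ∧ qr k ≤ 1)
    (hdomd : ∀ k, rhoOf (z k) * rhoOf (zb k) ≤ qd k ^ 2 * (rhoOf (z a) * rhoOf (zb a)) ∧
      rhoOf (z k) ≤ qd k * rhoOf (z a))
    (hdomr : ∀ k, rhoOf (1 - z k) * rhoOf (1 - zb k) ≤ qr k ^ 2 * (rhoOf (z a) * rhoOf (zb a)) ∧
      rhoOf (1 - zb k) ≤ qr k * rhoOf (z a))
    {slo shi ET : ℝ} (hc : 0 ≤ w 3 a - w 4 a - |w 2 a|)
    (hT : apexRest (w 3) z zb a qd qr slo ET + apexRest (w 4) z zb a qd qr slo ET +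
        apexRest (fun k => |w 2 k|) z zb a qd qr slo ET ≤
      (w 3 a - w 4 a - |w 2 a|) * ((1 - z a) * (1 - zb a)) ^ shi) :
    ∀ E : ℝ, ET ≤ E → ∀ j : ℕ, (j : ℝ) ≤ E → ∀ t ∈ Icc slo shi,
      0 ≤ oddDomEval z zb w t (radialMono E j) := by
  intro E hE j hj t ht
  have hqd0 : ∀ k, 0 < qd k := fun k => (hqd k).1
  have hqr0 : ∀ k, 0 < qr k := fun k => (hqr k).1
  have hone : |(1 : ℝ)| ≤ 1 := by simp
  have hmone : |(-1 : ℝ)| ≤ 1 := by simp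
  have b3 := (apex_bounds_pointFunctional_crossF_radialMono (w 3) z zb hz hzb hord a qd qr hqd0 hqr0
    hdomd hdomr hj t (-1) hmone).1
  have b4 := (apex_bounds_pointFunctional_crossF_radialMono (w 4) z zb hz hzb hord a qd qr hqd0 hqr0
    hdomd hdomr hj t 1 hone).2
  have b2 := (apex_bounds_pointFunctional_crossF_radialMono (fun k => |w 2 k|) z zb hz hzb hord a qd
    qr hqd0 hqr0 hdomd hdomr hj t 1 hone).2
  set P := radialMono E j (z a) (zb a) with hPdef
  set V := ((1 - z a) * (1 - zb a)) ^ t with hVdef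
  set R3 := apexRest (w 3) z zb a qd qr t E
  set R4 := apexRest (w 4) z zb a qd qr t E
  set R2 := apexRest (fun k => |w 2 k|) z zb a qd qr t E
  have hP : 0 ≤ P := radialMono_nonneg E j (hz a).1.le (hzb a).1.le
  have hva : 0 < (1 - z a) * (1 - zb a) ∧ (1 - z a) * (1 - zb a) ≤ 1 :=
    ⟨mul_pos (by linarith [(hz a).2]) (by linarith [(hzb a).2]),
      mul_le_one₀ (by linarith [(hz a).1]) (by linarith [(hzb a).2]) (by linarith [(hzb a).1])⟩
  have hV : ((1 - z a) * (1 - zb a)) ^ shi ≤ V :=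
    Real.rpow_le_rpow_of_exponent_ge hva.1 hva.2 ht.2
  have hqd0' : ∀ k, 0 ≤ qd k := fun k => (hqd0 k).le
  have hqr0' : ∀ k, 0 ≤ qr k := fun k => (hqr0 k).le
  have hR3 : R3 ≤ apexRest (w 3) z zb a qd qr slo ET :=
    (apexRest_anti_level (w 3) z zb hz hzb a qd qr hqd hqr t hE).trans
      (apexRest_anti_exponent (w 3) z zb hz hzb a qd qr hqd0' hqr0' ht.1 ET)
  have hR4 : R4 ≤ apexRest (w 4) z zb a qd qr slo ET :=
    (apexRest_anti_level (w 4) z zb hz hzb a qd qr hqd hqr t hE).trans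
      (apexRest_anti_exponent (w 4) z zb hz hzb a qd qr hqd0' hqr0' ht.1 ET)
  have hR2 : R2 ≤ apexRest (fun k => |w 2 k|) z zb a qd qr slo ET :=
    (apexRest_anti_level (fun k => |w 2 k|) z zb hz hzb a qd qr hqd hqr t hE).trans
      (apexRest_anti_exponent (fun k => |w 2 k|) z zb hz hzb a qd qr hqd0' hqr0' ht.1 ET)
  have key : P * ((w 3 a - w 4 a - |w 2 a|) * V - (R3 + R4 + R2)) ≤
      oddDomEval z zb w t (radialMono E j) := by
    have hre : P * ((w 3 a - w 4 a - |w 2 a|) * V - (R3 + R4 + R2)) =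
        P * (w 3 a * V - R3) - P * (w 4 a * V + R4) - P * (|w 2 a| * V + R2) := by ring
    rw [hre]
    unfold oddDomEval
    linarith [b3, b4, b2]
  have hin : 0 ≤ (w 3 a - w 4 a - |w 2 a|) * V - (R3 + R4 + R2) := by
    have := mul_le_mul_of_nonneg_left hV hc
    linarith
  exact (mul_nonneg hP hin).trans key

/-! ### (D5^ρ): the odd sector from the radial pair clause and the two rules -/

/-- **The radial pair clause at `(Δ, ℓ)`** — what a radial block clause ("A2ρ") would supply there: every
typed pair of odd-sector blocks `(g^{Δσε,Δσε}_{Δ,ℓ}, g^{-Δσε,Δσε}_{Δ,ℓ})` carries the signed / prefactored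
radial expansions with a COMMON table `w ≥ 0` supported on `j ≤ ℓ + m` (Costa–Hansen–Penedones–Trevisani
2016 §2.1–2.2: `j ∈ {ℓ+m, ℓ+m-2, …}` and `w ≥ 0` by unitarity, for the prefactored `⟨εσσε⟩` block;
Dolan–Osborn 2011 eq. (2.23) for the signed `⟨σεσε⟩` one). Printed anchor for NON-identical scalars, at the level
of the correlator and family by family: Kravchuk–Qiao–Rychkov 2020 §4.1–4.2 — the prefactor
`[(1+ρ)(1+ρ̄)/((1-ρ)(1-ρ̄))]^{(Δ₁₂-Δ₃₄)/2}` relating `g̃₁₂₃₄` to `g₁₂₃₄` (eq. (4.5); for `⟨εσσε⟩` it is `v^{Δσε/2}` up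
to `2^{-ΣΔᵢ}`), absolute convergence of the `(ρ, ρ̄)` double series on the bidisc from radial quantization (eq. (4.6)),
and NON-NEGATIVE coefficients `|λ̃_{12ψ}|²` for the conjugate orderings `⟨φ₁φ₂φ₂†φ₁†⟩` (eqs. (4.7)–(4.8)) — `⟨εσσε⟩`
is one (`σ, ε` Hermitian); `w ≥ 0` in the Legendre basis is the regrouping of these norms into `SO(3)` multiplets.
A HYPOTHESIS (a predicate on the point), not a consequence of `IsConformalBlock3D`.
[cite: CostaHansenPenedonesTrevisani2016, §2.1 eq. (2.11)] [cite: KravchukQiaoRychkov2020, §4.2 eqs. (4.7)–(4.8)] -/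
def RadialPairClause (Δσ Δε Δ : ℝ) (ℓ : ℕ) : Prop :=
  ∀ g₁ g₂ : ℝ → ℝ → ℝ, IsConformalBlock3D (Δσ - Δε) (Δσ - Δε) Δ ℓ g₁ →
    IsConformalBlock3D (-(Δσ - Δε)) (Δσ - Δε) Δ ℓ g₂ →
      ∃ wr : ℕ × ℕ → ℝ, (∀ q, 0 ≤ wr q) ∧ (∀ q : ℕ × ℕ, ℓ + q.1 < q.2 → wr q = 0) ∧
        HasSignedRadialExpansion Δ wr g₁ ∧ HasRadialExpansion ((Δσ - Δε) / 2) Δ wr g₂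

/-- The clause implies the support-free hypothesis of `oddPositive_of_radial`. [folklore] -/
theorem RadialPairClause.exists_expansions {Δσ Δε Δ : ℝ} {ℓ : ℕ} (h : RadialPairClause Δσ Δε Δ ℓ)
    (g₁ g₂ : ℝ → ℝ → ℝ) (hg₁ : IsConformalBlock3D (Δσ - Δε) (Δσ - Δε) Δ ℓ g₁)
    (hg₂ : IsConformalBlock3D (-(Δσ - Δε)) (Δσ - Δε) Δ ℓ g₂) :
    ∃ wr : ℕ × ℕ → ℝ, (∀ q, 0 ≤ wr q) ∧ HasSignedRadialExpansion Δ wr g₁ ∧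
      HasRadialExpansion ((Δσ - Δε) / 2) Δ wr g₂ := by
  obtain ⟨wr, hw, -, h₁, h₂⟩ := h g₁ g₂ hg₁ hg₂
  exact ⟨wr, hw, h₁, h₂⟩

/-- **(D5^ρ) at one point.** At `(Δ, ℓ)` strictly above the unitarity bound with `Δ ≥ E₀`, where the
radial pair clause holds: non-negativity of `𝔇_w[s′; 𝒫^ρ_{E,j}]` (`s′ = (Δσ+Δε)/2`) for `E ∈ [E₀, E_T)`,
`j + τ ≤ E` (rule (M^ρ) on the twist-gap domain, `τ ≤ 1`, `τ ≤ E₀`) and for `E ≥ E_T`, `j ≤ E` (rule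
(T^ρ)) gives `OddPositive` — every spin, either parity, no Cauchy–Schwarz budget (the radial index
`(m, j)` has `j + τ ≤ ℓ + m + τ ≤ Δ + m = E`; off the support the term vanishes).
[cite: CostaHansenPenedonesTrevisani2016, §2.1] -/
theorem tail_oddPositive_of_radial_rules {N : ℕ} (z zb : Fin N → ℝ) (w : Fin 5 → Fin N → ℝ)
    (hz : ∀ k, z k ∈ Ioo (0 : ℝ) 1) (hzb : ∀ k, zb k ∈ Ioo (0 : ℝ) 1) {Δσ Δε E₀ ET τ : ℝ}
    (hτ1 : τ ≤ 1) (hτ0 : τ ≤ E₀)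
    (hM : ∀ (j : ℕ) (E : ℝ), E₀ ≤ E → E < ET → (j : ℝ) + τ ≤ E →
      0 ≤ oddDomEval z zb w ((Δσ + Δε) / 2) (radialMono E j))
    (hT : ∀ E : ℝ, ET ≤ E → ∀ j : ℕ, (j : ℝ) ≤ E →
      0 ≤ oddDomEval z zb w ((Δσ + Δε) / 2) (radialMono E j))
    {Δ : ℝ} {ℓ : ℕ} (hΔ : unitarityBound3D ℓ < Δ) (hΔ0 : E₀ ≤ Δ)
    (hρ : RadialPairClause Δσ Δε Δ ℓ) :
    (CrossingFunctional.ofPoints z zb w).OddPositive Δσ Δε Δ ℓ := by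
  intro g₁ g₂ hg₁ hg₂
  obtain ⟨wr, hw, hsupp, h₁, h₂⟩ := hρ g₁ g₂ hg₁ hg₂
  refine (hasSum_oddForm_radial z zb w hz hzb h₁ h₂).nonneg fun q => ?_
  by_cases hq : ℓ + q.1 < q.2
  · simp [oddTermRadial, hsupp q hq]
  · have hq1 : (q.2 : ℝ) ≤ (ℓ : ℝ) + (q.1 : ℝ) := by exact_mod_cast not_lt.1 hq
    have hℓτ : (ℓ : ℝ) + τ ≤ Δ := natCast_add_le_of_unitarityBound3D_lt hτ1 hτ0 hΔ hΔ0
    have hjE : (q.2 : ℝ) + τ ≤ Δ + (q.1 : ℝ) := by linarith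
    have hjE' : (q.2 : ℝ) ≤ Δ + (q.1 : ℝ) := by
      linarith [natCast_add_half_le_unitarityBound3D ℓ]
    have hE0 : E₀ ≤ Δ + (q.1 : ℝ) := hΔ0.trans (le_add_of_nonneg_right (Nat.cast_nonneg _))
    refine oddTermRadial_nonneg_of_oddDomEval_nonneg z zb w hz hzb Δσ Δε Δ ℓ q (hw q) ?_
    by_cases hlt : Δ + (q.1 : ℝ) < ET
    · exact hM q.2 _ hE0 hlt hjE
    · exact hT _ (not_lt.1 hlt) q.2 hjE'

/-- **(D5^ρ) on a box, all points.** Uniformly for `(Δ_σ, Δ_ε) ∈ Q ⊆ [σ_lo,σ_hi] × [ε_lo,ε_hi]`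
(`s′ = (Δσ+Δε)/2 ∈ [(σ_lo+ε_lo)/2, (σ_hi+ε_hi)/2]`), with (T^ρ) discharged by the radial apex numbers of
`oddDomEval_radialMono_nonneg_of_apex`, at every `Δ ≥ E₀` with `unitarityBound3D ℓ ≤ Δ`, every spin,
either parity — given the radial pair clause at every REGULAR `Δ' ≥ E₀` strictly above the bound
(non-regular points follow by right limits, `oddPositive_ofPoints_of_eventually_right`).
[cite: CostaHansenPenedonesTrevisani2016, §2.1] -/
theorem tail_oddPositive_of_radial_boxes_and_apex {N : ℕ} (z zb : Fin N → ℝ)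
    (w : Fin 5 → Fin N → ℝ) (hz : ∀ k, z k ∈ Ioo (0 : ℝ) 1) (hzb : ∀ k, zb k ∈ Ioo (0 : ℝ) 1)
    (hord : ∀ k, zb k ≤ z k) (a : Fin N) (qd qr : Fin N → ℝ) (hqd : ∀ k, 0 < qd k ∧ qd k ≤ 1)
    (hqr : ∀ k, 0 < qr k ∧ qr k ≤ 1)
    (hdomd : ∀ k, rhoOf (z k) * rhoOf (zb k) ≤ qd k ^ 2 * (rhoOf (z a) * rhoOf (zb a)) ∧
      rhoOf (z k) ≤ qd k * rhoOf (z a))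
    (hdomr : ∀ k, rhoOf (1 - z k) * rhoOf (1 - zb k) ≤ qr k ^ 2 * (rhoOf (z a) * rhoOf (zb a)) ∧
      rhoOf (1 - zb k) ≤ qr k * rhoOf (z a))
    {Q : Set (ℝ × ℝ)} {σlo σhi εlo εhi E₀ ET τ : ℝ}
    (hQ : ∀ p ∈ Q, (σlo ≤ p.1 ∧ p.1 ≤ σhi) ∧ (εlo ≤ p.2 ∧ p.2 ≤ εhi))
    (hτ1 : τ ≤ 1) (hτ0 : τ ≤ E₀)
    (hM : ∀ (j : ℕ) (E : ℝ), E₀ ≤ E → E < ET → (j : ℝ) + τ ≤ E → ∀ p ∈ Q,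
      0 ≤ oddDomEval z zb w ((p.1 + p.2) / 2) (radialMono E j))
    (hc : 0 ≤ w 3 a - w 4 a - |w 2 a|)
    (hTodd : apexRest (w 3) z zb a qd qr ((σlo + εlo) / 2) ET +
        apexRest (w 4) z zb a qd qr ((σlo + εlo) / 2) ET +
        apexRest (fun k => |w 2 k|) z zb a qd qr ((σlo + εlo) / 2) ET ≤
      (w 3 a - w 4 a - |w 2 a|) * ((1 - z a) * (1 - zb a)) ^ ((σhi + εhi) / 2))
    (hρ : ∀ p ∈ Q, ∀ ℓ : ℕ, ∀ Δ : ℝ, unitarityBound3D ℓ < Δ → ¬ accidentalDegeneracy3D Δ ℓ →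
      E₀ ≤ Δ → RadialPairClause p.1 p.2 Δ ℓ) :
    ∀ p ∈ Q, ∀ ℓ : ℕ, ∀ Δ : ℝ, unitarityBound3D ℓ ≤ Δ → E₀ ≤ Δ →
      (CrossingFunctional.ofPoints z zb w).OddPositive p.1 p.2 Δ ℓ := by
  intro p hp ℓ Δ hbd hΔ0
  have hT := oddDomEval_radialMono_nonneg_of_apex z zb w hz hzb hord a qd qr hqd hqr hdomd hdomr hc
    hTodd
  have hs : (p.1 + p.2) / 2 ∈ Icc ((σlo + εlo) / 2) ((σhi + εhi) / 2) :=
    ⟨by linarith [(hQ p hp).1.1, (hQ p hp).2.1], by linarith [(hQ p hp).1.2, (hQ p hp).2.2]⟩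
  have hTp : ∀ E : ℝ, ET ≤ E → ∀ j : ℕ, (j : ℝ) ≤ E →
      0 ≤ oddDomEval z zb w ((p.1 + p.2) / 2) (radialMono E j) :=
    fun E hE j hj => hT E hE j hj _ hs
  have hMp : ∀ (j : ℕ) (E : ℝ), E₀ ≤ E → E < ET → (j : ℝ) + τ ≤ E →
      0 ≤ oddDomEval z zb w ((p.1 + p.2) / 2) (radialMono E j) :=
    fun j E hE hlt hj => hM j E hE hlt hj p hp
  by_cases hregpt : IsRegularPoint3D Δ ℓ
  · have hΔ : unitarityBound3D ℓ < Δ := lt_of_le_of_ne hbd (Ne.symm hregpt.1)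
    exact tail_oddPositive_of_radial_rules z zb w hz hzb hτ1 hτ0 hMp hTp hΔ hΔ0
      (hρ p hp ℓ Δ hΔ hregpt.2 hΔ0)
  · refine oddPositive_ofPoints_of_eventually_right z zb w hz hzb p.1 p.2 Δ ℓ hregpt ?_
    filter_upwards [eventually_isRegularPoint3D_nhdsGT_of_bound_le hbd, self_mem_nhdsWithin]
      with Δ' hΔ' hgt
    have hgt' : Δ < Δ' := Set.mem_Ioi.1 hgt
    have hbd' : unitarityBound3D ℓ < Δ' := lt_of_le_of_lt hbd hgt'
    exact ⟨hΔ', tail_oddPositive_of_radial_rules z zb w hz hzb hτ1 hτ0 hMp hTp hbd' (hΔ0.trans hgt'.le)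
      (hρ p hp ℓ Δ' hbd' hΔ'.2 (hΔ0.trans hgt'.le))⟩

end Literature.MathematicalPhysics.QuantumFieldTheory.ConformalBootstrap3D
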